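import Mathlib.Algebra.Order.BigOperators.Group.Finset
import Mathlib.Algebra.BigOperators.Ring.Finset
import Mathlib.Data.Int.Interval
import Mathlib.Tactic.Ring
import HarnessLib

/-!
# Bond-slot bookkeeping for layer chains: contact deficiency = broken bonds = run tops
# (helper toward `StackingLiminf`, stmt-Ventures-19145)

Cell `crystal3d-full`, venture `Summits/Ventures/Crystal3D`.  The registered word-free target
`stub_symChainBound` and the LayerChain functional `chainContacts σ K X` (planner line `LayerChain`,
landed transfer `stub_layerDecomposition`, p456192) count CONTACTS of a finitely supported chain
`X : ℤ → Finset (ℤ × ℤ)` of triangular-lattice layers: in-layer pairs with offset in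
`{(1,0), (0,1), (-1,1)}` and, across the gap `k → k+1`, pairs with offset in `D = {(0,0), (-1,0), (0,-1)}`
read upward for the letter `σ k = 1` and downward otherwise.

This file rewrites the DEFICIENCY `6 · #points − #contacts` exactly as a number of BROKEN BONDS, i.e. of
RUN TOPS `#{p ∈ X : p + u ∉ Y}` ("bond slots": every site has 6 in-layer, 3 upward and 3 downward slots):

* `card_pairs_add_sum_runTops` — for finite `X, Y ⊆ G` and a finite offset set `U`:
  `#{(p,q) ∈ X × Y : q − p ∈ U} + ∑_{u ∈ U} #{p ∈ X : p + u ∉ Y} = #U · #X`, and the partner form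
  `… + ∑_{u ∈ U} #{q ∈ Y : q − u ∉ X} = #U · #Y` (`card_pairs_add_sum_runBots`);
* `six_mul_chainCard_eq` — for every word `σ` and every finitely supported chain:
  `6 · ∑_k #X_k = chainContacts σ K X + ∑_{k ∈ K} (inLayerTops k + upTops k)`, where the two
  deficiency terms are sums of run-top counts over the three in-layer offsets and over the three upward
  offsets of gap `k` (letters read off `σ`); `six_mul_chainCard_eq_down` is the same with the DOWNWARD
  broken bonds of each layer across the gap below it (so the upward and downward totals agree, and
  `6N − chainContacts = inLayerTops + ½ (upTops + downTops)` = half the number of broken directed bonds).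

So `6N − chainContacts` is a sum of `#{p ∈ A : p + w ∉ B}` terms between equal or consecutive layers —
the form in which the window/coarea calculus of `…StackingLiminfWindowCoarea.lean` applies direction by
direction (density Brunn–Minkowski route; seat memo `DensityBM.md`, evidence on stmt-Ventures-19145), and
the discrete counterpart of the `BV`/symmetric-difference form `½ ∑_d #(X_{k+1} △ (X_k + d))` of the
interface term.  WHAT THIS IS NOT: any inequality toward the crux; pure bookkeeping valid for every word.
-/

namespace Summit.Ventures.Crystal3D.Theorems

open Finset

section Slots

variable {G : Type*} [AddCommGroup G] [DecidableEq G]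

/-- The pairs `(p, q) ∈ X × Y` with `q − p = u` are in bijection with `{p ∈ X : p + u ∈ Y}`. -/
theorem card_pairs_eq_card_filter (X Y : Finset G) (u : G) :
    ((X ×ˢ Y).filter fun pq => pq.2 - pq.1 = u).card = (X.filter fun p => p + u ∈ Y).card := by
  refine card_nbij' (fun pq => pq.1) (fun p => (p, p + u)) (fun pq hpq => ?_) (fun p hp => ?_)
    (fun pq hpq => ?_) (fun p _ => by simp)
  · rw [mem_coe, mem_filter, mem_product] at hpq
    rw [mem_coe, mem_filter]
    refine ⟨hpq.1.1, ?_⟩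
    rw [← hpq.2, add_sub_cancel]
    exact hpq.1.2
  · rw [mem_coe, mem_filter] at hp
    rw [mem_coe, mem_filter, mem_product]
    exact ⟨⟨hp.1, hp.2⟩, by simp⟩
  · rw [mem_coe, mem_filter] at hpq
    ext
    · rfl
    · show pq.1 + u = pq.2
      rw [← hpq.2, add_sub_cancel]

/-- Pairs with offset in a finite set `U`, counted offset by offset. -/
theorem card_pairs_eq_sum (X Y : Finset G) (U : Finset G) :
    ((X ×ˢ Y).filter fun pq => pq.2 - pq.1 ∈ U).card =
      ∑ u ∈ U, (X.filter fun p => p + u ∈ Y).card := by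
  have H : Set.MapsTo (fun pq : G × G => pq.2 - pq.1)
      (((X ×ˢ Y).filter fun pq => pq.2 - pq.1 ∈ U : Finset (G × G)) : Set (G × G)) (U : Set G) :=
    fun pq hpq => mem_coe.2 (mem_filter.1 (mem_coe.1 hpq)).2
  rw [card_eq_sum_card_fiberwise H]
  refine sum_congr rfl fun u hu => ?_
  rw [← card_pairs_eq_card_filter X Y u, filter_filter]
  congr 1
  ext pq
  simp only [mem_filter, mem_product]
  constructor
  · rintro ⟨hpq, _, h⟩
    exact ⟨hpq, h⟩
  · rintro ⟨hpq, h⟩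
    exact ⟨hpq, h ▸ hu, h⟩

/-- BOND SLOTS, base form: `#{(p,q) ∈ X × Y : q − p ∈ U} + ∑_{u ∈ U} #{p ∈ X : p + u ∉ Y} = #U · #X`
(each `p ∈ X` has `#U` slots `p + u`; a slot is a contact or a broken bond = run top). -/
theorem card_pairs_add_sum_runTops (X Y : Finset G) (U : Finset G) :
    ((X ×ˢ Y).filter fun pq => pq.2 - pq.1 ∈ U).card +
        ∑ u ∈ U, (X.filter fun p => p + u ∉ Y).card = U.card * X.card := by
  rw [card_pairs_eq_sum, ← sum_add_distrib]
  rw [show U.card * X.card = ∑ _u ∈ U, X.card by rw [sum_const_nat fun _ _ => rfl]]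
  exact sum_congr rfl fun u _ => card_filter_add_card_filter_not _

/-- BOND SLOTS, partner form: `#{(p,q) ∈ X × Y : q − p ∈ U} + ∑_{u ∈ U} #{q ∈ Y : q − u ∉ X} = #U · #Y`. -/
theorem card_pairs_add_sum_runBots (X Y : Finset G) (U : Finset G) :
    ((X ×ˢ Y).filter fun pq => pq.2 - pq.1 ∈ U).card +
        ∑ u ∈ U, (Y.filter fun q => q - u ∉ X).card = U.card * Y.card := by
  have hswap : ((X ×ˢ Y).filter fun pq => pq.2 - pq.1 ∈ U).card =
      ((Y ×ˢ X).filter fun qp => qp.2 - qp.1 ∈ U.image Neg.neg).card := by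
    refine card_nbij' Prod.swap Prod.swap (fun pq hpq => ?_) (fun qp hqp => ?_)
      (fun _ _ => rfl) (fun _ _ => rfl)
    · have h := mem_filter.1 (mem_coe.1 hpq)
      have h1 := mem_product.1 h.1
      refine mem_coe.2 (mem_filter.2 ⟨mem_product.2 ⟨h1.2, h1.1⟩, mem_image.2 ⟨_, h.2, ?_⟩⟩)
      simp only [Prod.fst_swap, Prod.snd_swap, neg_sub]
    · have h := mem_filter.1 (mem_coe.1 hqp)
      have h1 := mem_product.1 h.1
      obtain ⟨u, hu, hu'⟩ := mem_image.1 h.2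
      refine mem_coe.2 (mem_filter.2 ⟨mem_product.2 ⟨h1.2, h1.1⟩, ?_⟩)
      simp only [Prod.fst_swap, Prod.snd_swap]
      have : qp.1 - qp.2 = u := by rw [← neg_sub, ← hu', neg_neg]
      rw [this]
      exact hu
  rw [hswap, ← card_image_of_injective U neg_injective]
  have := card_pairs_add_sum_runTops Y X (U.image Neg.neg)
  rw [sum_image fun u _ u' _ h => neg_injective h] at this
  simpa only [← sub_eq_add_neg] using this

end Slots

section Chain

/-- The three in-layer offsets (one per `±` pair of triangular-lattice neighbours). -/
private theorem card_U3 : ({(1, 0), (0, 1), (-1, 1)} : Finset (ℤ × ℤ)).card = 3 := by decide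

/-- The three upward offsets across a `+1` gap. -/
private theorem card_D3 : ({(0, 0), (-1, 0), (0, -1)} : Finset (ℤ × ℤ)).card = 3 := by decide

/-- Per layer: in-layer contacts + in-layer run tops = `3 · #X`. -/
theorem inLayer_slots (X : Finset (ℤ × ℤ)) :
    ((X ×ˢ X).filter fun pq : (ℤ × ℤ) × (ℤ × ℤ) =>
        pq.2 - pq.1 ∈ ({(1, 0), (0, 1), (-1, 1)} : Finset (ℤ × ℤ))).card +
      ∑ u ∈ ({(1, 0), (0, 1), (-1, 1)} : Finset (ℤ × ℤ)), (X.filter fun p => p + u ∉ X).card =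
      3 * X.card := by
  rw [card_pairs_add_sum_runTops, card_U3]

/-- Per gap, read upward (letter `+1`): cross contacts + upward broken bonds of the lower layer
`= 3 · #X`, and cross contacts + downward broken bonds of the upper layer `= 3 · #Y`. -/
theorem gap_slots (X Y : Finset (ℤ × ℤ)) :
    (((X ×ˢ Y).filter fun pq : (ℤ × ℤ) × (ℤ × ℤ) =>
        pq.2 - pq.1 ∈ ({(0, 0), (-1, 0), (0, -1)} : Finset (ℤ × ℤ))).card +
      ∑ d ∈ ({(0, 0), (-1, 0), (0, -1)} : Finset (ℤ × ℤ)), (X.filter fun p => p + d ∉ Y).card =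
      3 * X.card) ∧
    (((X ×ˢ Y).filter fun pq : (ℤ × ℤ) × (ℤ × ℤ) =>
        pq.2 - pq.1 ∈ ({(0, 0), (-1, 0), (0, -1)} : Finset (ℤ × ℤ))).card +
      ∑ d ∈ ({(0, 0), (-1, 0), (0, -1)} : Finset (ℤ × ℤ)), (Y.filter fun q => q - d ∉ X).card =
      3 * Y.card) := by
  rw [card_pairs_add_sum_runTops, card_pairs_add_sum_runBots, card_D3]
  exact ⟨rfl, rfl⟩

/-- Upward broken bonds of layer `k` across gap `k` (letter `σ k`; for `σ k ≠ 1` the gap is read from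
layer `k+1` down to layer `k`, so the slots of a point `p ∈ X k` are `p − d`). -/
theorem up_slots (σ : ℤ → ℤ) (X : ℤ → Finset (ℤ × ℤ)) (k : ℤ) :
    (if σ k = 1 then ((X k ×ˢ X (k + 1)).filter fun pq : (ℤ × ℤ) × (ℤ × ℤ) =>
        pq.2 - pq.1 ∈ ({(0, 0), (-1, 0), (0, -1)} : Finset (ℤ × ℤ))).card
      else ((X (k + 1) ×ˢ X k).filter fun pq : (ℤ × ℤ) × (ℤ × ℤ) =>
        pq.2 - pq.1 ∈ ({(0, 0), (-1, 0), (0, -1)} : Finset (ℤ × ℤ))).card) +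
      (if σ k = 1 then
        ∑ d ∈ ({(0, 0), (-1, 0), (0, -1)} : Finset (ℤ × ℤ)), ((X k).filter fun p => p + d ∉ X (k + 1)).card
      else
        ∑ d ∈ ({(0, 0), (-1, 0), (0, -1)} : Finset (ℤ × ℤ)), ((X k).filter fun p => p - d ∉ X (k + 1)).card) =
      3 * (X k).card := by
  split_ifs
  · exact (gap_slots (X k) (X (k + 1))).1
  · exact (gap_slots (X (k + 1)) (X k)).2

/-- Downward broken bonds of layer `k + 1` across gap `k`. -/
theorem down_slots (σ : ℤ → ℤ) (X : ℤ → Finset (ℤ × ℤ)) (k : ℤ) :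
    (if σ k = 1 then ((X k ×ˢ X (k + 1)).filter fun pq : (ℤ × ℤ) × (ℤ × ℤ) =>
        pq.2 - pq.1 ∈ ({(0, 0), (-1, 0), (0, -1)} : Finset (ℤ × ℤ))).card
      else ((X (k + 1) ×ˢ X k).filter fun pq : (ℤ × ℤ) × (ℤ × ℤ) =>
        pq.2 - pq.1 ∈ ({(0, 0), (-1, 0), (0, -1)} : Finset (ℤ × ℤ))).card) +
      (if σ k = 1 then
        ∑ d ∈ ({(0, 0), (-1, 0), (0, -1)} : Finset (ℤ × ℤ)),
          ((X (k + 1)).filter fun q => q - d ∉ X k).card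
      else
        ∑ d ∈ ({(0, 0), (-1, 0), (0, -1)} : Finset (ℤ × ℤ)),
          ((X (k + 1)).filter fun q => q + d ∉ X k).card) =
      3 * (X (k + 1)).card := by
  split_ifs
  · exact (gap_slots (X k) (X (k + 1))).2
  · exact (gap_slots (X (k + 1)) (X k)).1

/-- Re-indexing the gap sum: for a finitely supported chain, summing the gap-`(k−1)` contact counts over
the layers `k ∈ K` gives the same total as summing the gap-`k` counts over `k ∈ K` (gaps with an empty
side contribute nothing). -/
theorem sum_gap_shift (K : Finset ℤ) (X : ℤ → Finset (ℤ × ℤ)) (hX : ∀ k, k ∉ K → X k = ∅)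
    (g : Finset (ℤ × ℤ) → Finset (ℤ × ℤ) → ℤ → ℕ) (hg0 : ∀ A k, g ∅ A k = 0)
    (hg1 : ∀ A k, g A ∅ k = 0) :
    ∑ k ∈ K, g (X (k - 1)) (X k) (k - 1) = ∑ k ∈ K, g (X k) (X (k + 1)) k := by
  have h1 : ∑ k ∈ K, g (X (k - 1)) (X k) (k - 1) =
      ∑ j ∈ K.image (fun k => k - 1), g (X j) (X (j + 1)) j := by
    rw [sum_image fun (a : ℤ) _ (b : ℤ) _ (h : a - 1 = b - 1) => sub_left_injective h]
    refine sum_congr rfl fun k _ => ?_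
    rw [sub_add_cancel]
  rw [h1]
  -- both sums extend by zero to `K ∪ K.image (· - 1)`
  have hL : ∑ j ∈ K.image (fun k => k - 1), g (X j) (X (j + 1)) j =
      ∑ j ∈ K ∪ K.image (fun k => k - 1), g (X j) (X (j + 1)) j := by
    refine sum_subset subset_union_right fun j hj hj' => ?_
    have hjK : j ∈ K := by
      rcases mem_union.1 hj with h | h
      · exact h
      · exact absurd h hj'
    have : j + 1 ∉ K := by
      intro h
      exact hj' (mem_image.2 ⟨j + 1, h, by ring⟩)
    rw [hX _ this, hg1]
  have hR : ∑ j ∈ K, g (X j) (X (j + 1)) j =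
      ∑ j ∈ K ∪ K.image (fun k => k - 1), g (X j) (X (j + 1)) j := by
    refine sum_subset subset_union_left fun j _ hj' => ?_
    rw [hX _ hj', hg0]
  rw [hL, hR]

/-- BOND SLOTS FOR A CHAIN (every word `σ`, every chain `X` over a finite index set `K`): `6 · #points` equals the
LayerChain contact count `chainContacts σ K X` (in-layer pairs + gap pairs read along the letters) plus
the in-layer run tops, plus the upward broken bonds of each layer across the gap above it, plus the
downward broken bonds of each layer across the gap below it. -/
theorem six_mul_chainCard_eq (σ : ℤ → ℤ) (K : Finset ℤ) (X : ℤ → Finset (ℤ × ℤ)) :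
    6 * ∑ k ∈ K, (X k).card =
      ((∑ k ∈ K, ((X k ×ˢ X k).filter fun pq : (ℤ × ℤ) × (ℤ × ℤ) =>
          pq.2 - pq.1 ∈ ({(1, 0), (0, 1), (-1, 1)} : Finset (ℤ × ℤ))).card) +
        ∑ k ∈ K, (if σ k = 1 then ((X k ×ˢ X (k + 1)).filter fun pq : (ℤ × ℤ) × (ℤ × ℤ) =>
            pq.2 - pq.1 ∈ ({(0, 0), (-1, 0), (0, -1)} : Finset (ℤ × ℤ))).card
          else ((X (k + 1) ×ˢ X k).filter fun pq : (ℤ × ℤ) × (ℤ × ℤ) =>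
            pq.2 - pq.1 ∈ ({(0, 0), (-1, 0), (0, -1)} : Finset (ℤ × ℤ))).card)) +
      ((∑ k ∈ K, ∑ u ∈ ({(1, 0), (0, 1), (-1, 1)} : Finset (ℤ × ℤ)),
          ((X k).filter fun p => p + u ∉ X k).card) +
        ∑ k ∈ K, (if σ k = 1 then
            ∑ d ∈ ({(0, 0), (-1, 0), (0, -1)} : Finset (ℤ × ℤ)),
              ((X k).filter fun p => p + d ∉ X (k + 1)).card
          else
            ∑ d ∈ ({(0, 0), (-1, 0), (0, -1)} : Finset (ℤ × ℤ)),
              ((X k).filter fun p => p - d ∉ X (k + 1)).card)) := by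
  -- in-layer slots
  have hin : ∀ k ∈ K, ((X k ×ˢ X k).filter fun pq : (ℤ × ℤ) × (ℤ × ℤ) =>
        pq.2 - pq.1 ∈ ({(1, 0), (0, 1), (-1, 1)} : Finset (ℤ × ℤ))).card +
      ∑ u ∈ ({(1, 0), (0, 1), (-1, 1)} : Finset (ℤ × ℤ)), ((X k).filter fun p => p + u ∉ X k).card =
      3 * (X k).card := fun k _ => inLayer_slots (X k)
  have hup : ∑ k ∈ K, ((if σ k = 1 then ((X k ×ˢ X (k + 1)).filter fun pq : (ℤ × ℤ) × (ℤ × ℤ) =>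
        pq.2 - pq.1 ∈ ({(0, 0), (-1, 0), (0, -1)} : Finset (ℤ × ℤ))).card
      else ((X (k + 1) ×ˢ X k).filter fun pq : (ℤ × ℤ) × (ℤ × ℤ) =>
        pq.2 - pq.1 ∈ ({(0, 0), (-1, 0), (0, -1)} : Finset (ℤ × ℤ))).card) +
      (if σ k = 1 then
        ∑ d ∈ ({(0, 0), (-1, 0), (0, -1)} : Finset (ℤ × ℤ)), ((X k).filter fun p => p + d ∉ X (k + 1)).card
      else
        ∑ d ∈ ({(0, 0), (-1, 0), (0, -1)} : Finset (ℤ × ℤ)),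
          ((X k).filter fun p => p - d ∉ X (k + 1)).card)) =
      ∑ k ∈ K, 3 * (X k).card := sum_congr rfl fun k _ => up_slots σ X k
  rw [sum_add_distrib] at hup
  have htot : 6 * ∑ k ∈ K, (X k).card =
      ∑ k ∈ K, 3 * (X k).card + ∑ k ∈ K, 3 * (X k).card := by
    rw [← sum_add_distrib, mul_sum]
    exact sum_congr rfl fun k _ => by ring
  have hin' : ∑ k ∈ K, ((X k ×ˢ X k).filter fun pq : (ℤ × ℤ) × (ℤ × ℤ) =>
        pq.2 - pq.1 ∈ ({(1, 0), (0, 1), (-1, 1)} : Finset (ℤ × ℤ))).card +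
      ∑ k ∈ K, ∑ u ∈ ({(1, 0), (0, 1), (-1, 1)} : Finset (ℤ × ℤ)),
        ((X k).filter fun p => p + u ∉ X k).card = ∑ k ∈ K, 3 * (X k).card := by
    rw [← sum_add_distrib]
    exact sum_congr rfl hin
  omega

/-- BOND SLOTS FOR A CHAIN, downward form: the same identity with, for each layer `k`, its DOWNWARD broken
bonds across the gap `k − 1` below it (letter `σ (k−1)`); needs the finite-support hypothesis (gaps with an
empty side carry no contacts).  Consequently the upward and downward broken-bond totals of a chain agree. -/
theorem six_mul_chainCard_eq_down (σ : ℤ → ℤ) (K : Finset ℤ) (X : ℤ → Finset (ℤ × ℤ))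
    (hX : ∀ k, k ∉ K → X k = ∅) :
    6 * ∑ k ∈ K, (X k).card =
      ((∑ k ∈ K, ((X k ×ˢ X k).filter fun pq : (ℤ × ℤ) × (ℤ × ℤ) =>
          pq.2 - pq.1 ∈ ({(1, 0), (0, 1), (-1, 1)} : Finset (ℤ × ℤ))).card) +
        ∑ k ∈ K, (if σ k = 1 then ((X k ×ˢ X (k + 1)).filter fun pq : (ℤ × ℤ) × (ℤ × ℤ) =>
            pq.2 - pq.1 ∈ ({(0, 0), (-1, 0), (0, -1)} : Finset (ℤ × ℤ))).card
          else ((X (k + 1) ×ˢ X k).filter fun pq : (ℤ × ℤ) × (ℤ × ℤ) =>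
            pq.2 - pq.1 ∈ ({(0, 0), (-1, 0), (0, -1)} : Finset (ℤ × ℤ))).card)) +
      ((∑ k ∈ K, ∑ u ∈ ({(1, 0), (0, 1), (-1, 1)} : Finset (ℤ × ℤ)),
          ((X k).filter fun p => p + u ∉ X k).card) +
        ∑ k ∈ K, (if σ (k - 1) = 1 then
            ∑ d ∈ ({(0, 0), (-1, 0), (0, -1)} : Finset (ℤ × ℤ)),
              ((X k).filter fun q => q - d ∉ X (k - 1)).card
          else
            ∑ d ∈ ({(0, 0), (-1, 0), (0, -1)} : Finset (ℤ × ℤ)),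
              ((X k).filter fun q => q + d ∉ X (k - 1)).card)) := by
  have hin : ∀ k ∈ K, ((X k ×ˢ X k).filter fun pq : (ℤ × ℤ) × (ℤ × ℤ) =>
        pq.2 - pq.1 ∈ ({(1, 0), (0, 1), (-1, 1)} : Finset (ℤ × ℤ))).card +
      ∑ u ∈ ({(1, 0), (0, 1), (-1, 1)} : Finset (ℤ × ℤ)), ((X k).filter fun p => p + u ∉ X k).card =
      3 * (X k).card := fun k _ => inLayer_slots (X k)
  -- downward slots of layer k across gap k-1, written as a gap-(k-1) quantity
  have hdown : ∑ k ∈ K, ((if σ (k - 1) = 1 then ((X (k - 1) ×ˢ X (k - 1 + 1)).filter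
        fun pq : (ℤ × ℤ) × (ℤ × ℤ) => pq.2 - pq.1 ∈ ({(0, 0), (-1, 0), (0, -1)} : Finset (ℤ × ℤ))).card
      else ((X (k - 1 + 1) ×ˢ X (k - 1)).filter fun pq : (ℤ × ℤ) × (ℤ × ℤ) =>
        pq.2 - pq.1 ∈ ({(0, 0), (-1, 0), (0, -1)} : Finset (ℤ × ℤ))).card) +
      (if σ (k - 1) = 1 then
        ∑ d ∈ ({(0, 0), (-1, 0), (0, -1)} : Finset (ℤ × ℤ)),
          ((X (k - 1 + 1)).filter fun q => q - d ∉ X (k - 1)).card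
      else
        ∑ d ∈ ({(0, 0), (-1, 0), (0, -1)} : Finset (ℤ × ℤ)),
          ((X (k - 1 + 1)).filter fun q => q + d ∉ X (k - 1)).card)) =
      ∑ k ∈ K, 3 * (X k).card := by
    refine sum_congr rfl fun k _ => ?_
    have := down_slots σ X (k - 1)
    rw [sub_add_cancel] at this ⊢
    exact this
  -- the gap-pair sum indexed by k-1 equals the one indexed by k
  have hshift := sum_gap_shift K X hX
    (fun A B k => if σ k = 1 then ((A ×ˢ B).filter fun pq : (ℤ × ℤ) × (ℤ × ℤ) =>
        pq.2 - pq.1 ∈ ({(0, 0), (-1, 0), (0, -1)} : Finset (ℤ × ℤ))).card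
      else ((B ×ˢ A).filter fun pq : (ℤ × ℤ) × (ℤ × ℤ) =>
        pq.2 - pq.1 ∈ ({(0, 0), (-1, 0), (0, -1)} : Finset (ℤ × ℤ))).card)
    (fun A k => by split_ifs <;> simp) (fun A k => by split_ifs <;> simp)
  simp only [sub_add_cancel] at hdown hshift
  rw [sum_add_distrib] at hdown
  rw [hshift] at hdown
  have htot : 6 * ∑ k ∈ K, (X k).card =
      ∑ k ∈ K, 3 * (X k).card + ∑ k ∈ K, 3 * (X k).card := by
    rw [← sum_add_distrib, mul_sum]
    exact sum_congr rfl fun k _ => by ring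
  have hin' : ∑ k ∈ K, ((X k ×ˢ X k).filter fun pq : (ℤ × ℤ) × (ℤ × ℤ) =>
        pq.2 - pq.1 ∈ ({(1, 0), (0, 1), (-1, 1)} : Finset (ℤ × ℤ))).card +
      ∑ k ∈ K, ∑ u ∈ ({(1, 0), (0, 1), (-1, 1)} : Finset (ℤ × ℤ)),
        ((X k).filter fun p => p + u ∉ X k).card = ∑ k ∈ K, 3 * (X k).card := by
    rw [← sum_add_distrib]
    exact sum_congr rfl hin
  omega

end Chain

end Summit.Ventures.Crystal3D.Theorems
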